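import Summits.Ventures.PercRepro2.CaseOneThickeningT
import Summits.Ventures.PercRepro2.CaseOnePairPocketMain

/-!
# The six-form calculus: the pocket and pair-pocket reductions (blind cell PercRepro2, p1 g31)

The T-pair `(Dto, Dt) = (P(Q, a₃ ∈ C₂, o ∈ U), P(Q, a₃ ∈ C₂))` is built from connection events among
the special vertices, so it transfers through the contraction of a pocket exactly like the PD pair and
the Q-pair (**`Dt_pocket`**, **`Dto_pocket`**, on the pattern of `Dqo_pocket`) and through the pair
gadget (**`Dt_pair`**, **`Dto_pair`**, on the pattern of `Dqo_pair`); with `iiExprT_pocket` /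
`iExprT_pocket` / `iiExprT_pair` / `iExprT_pair` the T-world forms `(ii-T)`, `(i-T)` are the same in `G`
and in the contracted graph (`zSplitIIT_pocket_iff`, `zSplitIT_pocket_iff`, `zSplitIIT_pair_iff`,
`zSplitIT_pair_iff`), hence so are the SIX forms (**`sixForms_pocket_iff`**, **`sixForms_pair_iff`**).
Consequences for the six-form closed property: **`closedAtT_of_pocket`** (the statement vertex moves
out of a mark-free pocket, through `sixForms_of_leaf_at`), **`closedAtT_of_pocket'`** (a pocket with
at most one special vertex is a pendant edge) and **`closedAtT_of_pair`** (a pocket with two of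
`o, a₃, b`, the roots outside, is its tree gadget) — the six-form twins of `closedAt_of_pocket`,
`closedAt_of_pocket'`, `closedAt_of_pair`. Own code; standard axioms.
-/

namespace Summit.Ventures.PercRepro2

namespace CaseOne

/-! ## The T-pair through a pocket -/

section PocketT
variable {V : Type*} {E : Type*} [Fintype E] [DecidableEq E] {R : Type*} [CommRing R]
variable {ends : E → Sym2 V} {W : Set V} {x : V} {P : Finset E} {e₀ : E} {o a₁ a₂ a₃ b z : V}

/-- `P(T)` is unchanged by the contraction of a pocket preserving `a₁, a₂, a₃`. -/
theorem Dt_pocket (p : E → R) (h : IsPocket ends W x P) (he : e₀ ∈ P) (h1 : a₁ ∉ W ∨ a₁ = z)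
    (h2 : a₂ ∉ W ∨ a₂ = z) (ha : a₃ ∉ W ∨ a₃ = z) :
    Dt p ends a₁ a₂ a₃ = Dt (pocketW p ends P e₀ z x) (pocketEnds ends P e₀ z x) a₁ a₂ a₃ := by
  unfold Dt
  rw [connEvent_pocket (a₃ := z) h he h2 ha, connEvent_pocket (a₃ := z) h he h1 h2]
  simp only [← Set.preimage_compl, ← Set.preimage_inter, prob_pocket p ends P e₀ z x]

/-- `P(T, o ∈ U)` is unchanged by the contraction of a pocket preserving `o, a₁, a₂, a₃`. -/
theorem Dto_pocket (p : E → R) (h : IsPocket ends W x P) (he : e₀ ∈ P) (ho : o ∉ W ∨ o = z)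
    (h1 : a₁ ∉ W ∨ a₁ = z) (h2 : a₂ ∉ W ∨ a₂ = z) (ha : a₃ ∉ W ∨ a₃ = z) :
    Dto p ends o a₁ a₂ a₃ =
      Dto (pocketW p ends P e₀ z x) (pocketEnds ends P e₀ z x) o a₁ a₂ a₃ := by
  unfold Dto
  rw [connEvent_pocket (a₃ := z) h he h1 ho, connEvent_pocket (a₃ := z) h he h2 ho,
    connEvent_pocket (a₃ := z) h he h2 ha, connEvent_pocket (a₃ := z) h he h1 h2]
  simp only [← Set.preimage_compl, ← Set.preimage_inter, ← Set.preimage_union,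
    prob_pocket p ends P e₀ z x]

end PocketT

section PocketTProps
variable {V : Type*} {E : Type*} [Fintype E] [DecidableEq E] {R : Type*} [CommRing R]
  [LinearOrder R]
variable {ends : E → Sym2 V} {W : Set V} {x : V} {P : Finset E} {e₀ : E} {o a₁ a₂ a₃ b z : V}
  (p : E → R) (h : IsPocket ends W x P) (he : e₀ ∈ P) (ho : o ∉ W ∨ o = z) (h1 : a₁ ∉ W ∨ a₁ = z)
  (h2 : a₂ ∉ W ∨ a₂ = z) (ha : a₃ ∉ W ∨ a₃ = z) (hb : b ∉ W ∨ b = z)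

include h he ho h1 h2 ha hb

/-- `(ii-T)` at `a₃` is the same in `G` and in the contracted graph. -/
theorem zSplitIIT_pocket_iff :
    ZSplitIIT p ends o a₁ a₂ a₃ b ↔
      ZSplitIIT (pocketW p ends P e₀ z x) (pocketEnds ends P e₀ z x) o a₁ a₂ a₃ b := by
  unfold ZSplitIIT
  rw [iiExprT_pocket p h he ho h1 h2 ha hb, Dto_pocket p h he ho h1 h2 ha, Dt_pocket p h he h1 h2 ha]

/-- `(i-T)` at `a₃` is the same in `G` and in the contracted graph. -/
theorem zSplitIT_pocket_iff :
    ZSplitIT p ends o a₁ a₂ a₃ b ↔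
      ZSplitIT (pocketW p ends P e₀ z x) (pocketEnds ends P e₀ z x) o a₁ a₂ a₃ b := by
  unfold ZSplitIT
  rw [iExprT_pocket p h he ho h1 h2 ha hb, Dto_pocket p h he ho h1 h2 ha, Dt_pocket p h he h1 h2 ha]

end PocketTProps

section PocketSix
variable {V : Type*} {E : Type*} [Fintype E] [DecidableEq E] {R : Type*} [Field R] [LinearOrder R]
  [IsStrictOrderedRing R]
variable {ends : E → Sym2 V} {W : Set V} {x : V} {P : Finset E} {e₀ : E} {o a₁ a₂ a₃ b z : V}

omit [IsStrictOrderedRing R] in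
/-- **The six forms at `a₃` are the same in `G` and in the contracted graph** whenever each of the five
special vertices is outside the pocket or is its designated vertex `z`. -/
theorem sixForms_pocket_iff (p : E → R) (h : IsPocket ends W x P) (he : e₀ ∈ P) (ho : o ∉ W ∨ o = z)
    (h1 : a₁ ∉ W ∨ a₁ = z) (h2 : a₂ ∉ W ∨ a₂ = z) (ha : a₃ ∉ W ∨ a₃ = z) (hb : b ∉ W ∨ b = z) :
    SixForms p ends o a₁ a₂ a₃ b ↔
      SixForms (pocketW p ends P e₀ z x) (pocketEnds ends P e₀ z x) o a₁ a₂ a₃ b := by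
  unfold SixForms
  rw [zSplitII_pocket_iff p h he ho h1 h2 ha hb, zSplitIIQ_pocket_iff p h he ho h1 h2 ha hb,
    zSplitIIT_pocket_iff p h he ho h1 h2 ha hb, zSplitI_pocket_iff p h he ho h1 h2 ha hb,
    zSplitIQ_pocket_iff p h he ho h1 h2 ha hb, zSplitIT_pocket_iff p h he ho h1 h2 ha hb]

/-- **The pocket reduction for the six forms**: if the statement vertex `a₃` lies in a pocket `(W, x, P)`
avoiding the marks, the six forms at `a₃` for one weight vector follow from the six forms at the cut
vertex `x` in the contracted graph under the contracted weights. -/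
theorem sixForms_of_pocket (p : E → R) (hp : IsProbVec p) (h : IsPocket ends W x P) (he : e₀ ∈ P)
    (ha : a₃ ∈ W) (ho : o ∉ W) (h1 : a₁ ∉ W) (h2 : a₂ ∉ W) (hb : b ∉ W)
    (hx : SixForms (pocketW p ends P e₀ a₃ x) (pocketEnds ends P e₀ a₃ x) o a₁ a₂ x b) :
    SixForms p ends o a₁ a₂ a₃ b := by
  have hp' : IsProbVec (pocketW p ends P e₀ a₃ x) := IsProbVec.pocketW hp ends P e₀ a₃ x
  have hl : IsLeafAt (pocketEnds ends P e₀ a₃ x) x a₃ e₀ := h.isLeafAt_pocketEnds e₀ ha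
  have ho' : o ≠ a₃ := fun h' => ho (h' ▸ ha)
  have h1' : a₁ ≠ a₃ := fun h' => h1 (h' ▸ ha)
  have h2' : a₂ ≠ a₃ := fun h' => h2 (h' ▸ ha)
  have hb' : b ≠ a₃ := fun h' => hb (h' ▸ ha)
  rw [sixForms_pocket_iff p h he (Or.inl ho) (Or.inl h1) (Or.inl h2) (Or.inr rfl) (Or.inl hb)]
  exact sixForms_of_leaf_at _ hp' hl o a₁ a₂ b ho' h1' h2' hb' hx

/-- **The statement vertex moves out of a mark-free pocket, for the six-form closed property**:
`ClosedAtT x` in the contracted graph gives `ClosedAtT a₃` in `G`. -/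
theorem closedAtT_of_pocket (h : IsPocket ends W x P) (he : e₀ ∈ P) (ha : a₃ ∈ W) (ho : o ∉ W)
    (h1 : a₁ ∉ W) (h2 : a₂ ∉ W) (hb : b ∉ W)
    (hc : ClosedAtT (R := R) o a₁ a₂ b E (pocketEnds ends P e₀ a₃ x) x) :
    ClosedAtT (R := R) o a₁ a₂ b E ends a₃ :=
  fun p hp => sixForms_of_pocket p hp h he ha ho h1 h2 hb
    (hc (pocketW p ends P e₀ a₃ x) (IsProbVec.pocketW hp ends P e₀ a₃ x))

/-- **A pocket preserving the five special vertices is a pendant edge, for the six-form closed property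
too**: whenever each of `o, a₁, a₂, a₃, b` is outside the pocket or is its designated vertex `z`,
`ClosedAtT a₃` in the contracted graph gives `ClosedAtT a₃` in `G`. -/
theorem closedAtT_of_pocket' {z : V} (h : IsPocket ends W x P) (he : e₀ ∈ P) (ho : o ∉ W ∨ o = z)
    (h1 : a₁ ∉ W ∨ a₁ = z) (h2 : a₂ ∉ W ∨ a₂ = z) (ha : a₃ ∉ W ∨ a₃ = z) (hb : b ∉ W ∨ b = z)
    (hc : ClosedAtT (R := R) o a₁ a₂ b E (pocketEnds ends P e₀ z x) a₃) :
    ClosedAtT (R := R) o a₁ a₂ b E ends a₃ :=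
  fun p hp => (sixForms_pocket_iff p h he ho h1 h2 ha hb).2
    (hc (pocketW p ends P e₀ z x) (IsProbVec.pocketW hp ends P e₀ z x))

end PocketSix

/-! ## The T-pair through the pair gadget -/

section PairT
variable {V : Type*} {E : Type*} [Fintype E] [DecidableEq E] {R : Type*} [Field R] [LinearOrder R]
  [IsStrictOrderedRing R]
variable {ends : E → Sym2 V} {W : Set V} {x : V} {P : Finset E} {e₁ e₂ e₃ : E} {w z₁ z₂ : V}
  {o a₁ a₂ a₃ b : V} {p : E → R} (hp : IsProbVec p) (hh : IsPairPocket ends W x P e₁ e₂ e₃ w z₁ z₂)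
  (h1 : a₁ ∉ W) (h2 : a₂ ∉ W)

include hp hh h1 h2

/-- `P(T)` transfers to the gadget. -/
theorem Dt_pair (ha : a₃ ∉ W ∨ a₃ = z₁ ∨ a₃ = z₂) :
    Dt p ends a₁ a₂ a₃ = Dt (pairW p ends P e₁ e₂ e₃ x z₁ z₂) (pairEnds ends P e₁ e₂ e₃ x w z₁ z₂)
      a₁ a₂ a₃ := by
  have E1 : ∀ {u v : V}, (u ∉ W ∨ u = z₁ ∨ u = z₂) → (v ∉ W ∨ v = z₁ ∨ v = z₂) →
      (u = v ∨ u ∉ W ∨ v ∉ W) →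
      connEvent ends u v = pairΘ ends P x z₁ z₂ ⁻¹' skelSet ends x z₁ z₂ u v :=
    fun hu hv hsep => connEvent_pair_skel hh.pocket hh.mem_z₁ hh.mem_z₂ hh.ne_z hu hv hsep
  have E2 : ∀ {u v : V}, (u ∉ W ∨ u = z₁ ∨ u = z₂) → (v ∉ W ∨ v = z₁ ∨ v = z₂) →
      (u = v ∨ u ∉ W ∨ v ∉ W) →
      connEvent (pairEnds ends P e₁ e₂ e₃ x w z₁ z₂) u v =
        pairΘ' P e₁ e₂ e₃ ⁻¹' skelSet ends x z₁ z₂ u v :=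
    fun hu hv hsep => connEvent_pairEnds_skel hh hu hv hsep
  unfold Dt
  rw [E1 (Or.inl h2) ha (Or.inr (Or.inl h2)), E1 (Or.inl h1) (Or.inl h2) (Or.inr (Or.inl h1)),
    E2 (Or.inl h2) ha (Or.inr (Or.inl h2)), E2 (Or.inl h1) (Or.inl h2) (Or.inr (Or.inl h1))]
  simp only [← Set.preimage_compl, ← Set.preimage_inter,
    prob_pair_skel ends P x z₁ z₂ hp hh.mem₁ hh.mem₂ hh.mem₃ hh.ne₁₂ hh.ne₁₃ hh.ne₂₃]

/-- `P(T, o ∈ U)` transfers to the gadget. -/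
theorem Dto_pair (ho : o ∉ W ∨ o = z₁ ∨ o = z₂) (ha : a₃ ∉ W ∨ a₃ = z₁ ∨ a₃ = z₂) :
    Dto p ends o a₁ a₂ a₃ =
      Dto (pairW p ends P e₁ e₂ e₃ x z₁ z₂) (pairEnds ends P e₁ e₂ e₃ x w z₁ z₂) o a₁ a₂ a₃ := by
  have E1 : ∀ {u v : V}, (u ∉ W ∨ u = z₁ ∨ u = z₂) → (v ∉ W ∨ v = z₁ ∨ v = z₂) →
      (u = v ∨ u ∉ W ∨ v ∉ W) →
      connEvent ends u v = pairΘ ends P x z₁ z₂ ⁻¹' skelSet ends x z₁ z₂ u v :=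
    fun hu hv hsep => connEvent_pair_skel hh.pocket hh.mem_z₁ hh.mem_z₂ hh.ne_z hu hv hsep
  have E2 : ∀ {u v : V}, (u ∉ W ∨ u = z₁ ∨ u = z₂) → (v ∉ W ∨ v = z₁ ∨ v = z₂) →
      (u = v ∨ u ∉ W ∨ v ∉ W) →
      connEvent (pairEnds ends P e₁ e₂ e₃ x w z₁ z₂) u v =
        pairΘ' P e₁ e₂ e₃ ⁻¹' skelSet ends x z₁ z₂ u v :=
    fun hu hv hsep => connEvent_pairEnds_skel hh hu hv hsep
  unfold Dto
  rw [E1 (Or.inl h1) ho (Or.inr (Or.inl h1)), E1 (Or.inl h2) ho (Or.inr (Or.inl h2)),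
    E1 (Or.inl h2) ha (Or.inr (Or.inl h2)), E1 (Or.inl h1) (Or.inl h2) (Or.inr (Or.inl h1)),
    E2 (Or.inl h1) ho (Or.inr (Or.inl h1)), E2 (Or.inl h2) ho (Or.inr (Or.inl h2)),
    E2 (Or.inl h2) ha (Or.inr (Or.inl h2)), E2 (Or.inl h1) (Or.inl h2) (Or.inr (Or.inl h1))]
  simp only [← Set.preimage_compl, ← Set.preimage_inter, ← Set.preimage_union,
    prob_pair_skel ends P x z₁ z₂ hp hh.mem₁ hh.mem₂ hh.mem₃ hh.ne₁₂ hh.ne₁₃ hh.ne₂₃]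

variable (ho : o ∉ W ∨ o = z₁ ∨ o = z₂) (ha : a₃ ∉ W ∨ a₃ = z₁ ∨ a₃ = z₂)
  (hb : b ∉ W ∨ b = z₁ ∨ b = z₂)

include ho ha hb

/-- `(ii-T)` at `a₃` is the same in `G` and in the tree gadget. -/
theorem zSplitIIT_pair_iff :
    ZSplitIIT p ends o a₁ a₂ a₃ b ↔
      ZSplitIIT (pairW p ends P e₁ e₂ e₃ x z₁ z₂) (pairEnds ends P e₁ e₂ e₃ x w z₁ z₂) o a₁ a₂ a₃ b := by
  unfold ZSplitIIT
  rw [iiExprT_pair hp hh h1 h2 ho ha hb, Dto_pair hp hh h1 h2 ho ha, Dt_pair hp hh h1 h2 ha]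

/-- `(i-T)` at `a₃` is the same in `G` and in the tree gadget. -/
theorem zSplitIT_pair_iff :
    ZSplitIT p ends o a₁ a₂ a₃ b ↔
      ZSplitIT (pairW p ends P e₁ e₂ e₃ x z₁ z₂) (pairEnds ends P e₁ e₂ e₃ x w z₁ z₂) o a₁ a₂ a₃ b := by
  unfold ZSplitIT
  rw [iExprT_pair hp hh h1 h2 ho ha hb, Dto_pair hp hh h1 h2 ho ha, Dt_pair hp hh h1 h2 ha]

/-- **The six forms at `a₃` are the same in `G` and in the tree gadget.** -/
theorem sixForms_pair_iff :
    SixForms p ends o a₁ a₂ a₃ b ↔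
      SixForms (pairW p ends P e₁ e₂ e₃ x z₁ z₂) (pairEnds ends P e₁ e₂ e₃ x w z₁ z₂) o a₁ a₂ a₃ b := by
  have h4 := fourForms_pair_iff hp hh h1 h2 ho ha hb
  have hT := zSplitIIT_pair_iff hp hh h1 h2 ho ha hb
  have hT' := zSplitIT_pair_iff hp hh h1 h2 ho ha hb
  unfold FourForms at h4
  unfold SixForms
  constructor
  · rintro ⟨k1, k2, k3, k4, k5, k6⟩
    obtain ⟨m1, m2, m4, m5⟩ := h4.1 ⟨k1, k2, k4, k5⟩
    exact ⟨m1, m2, hT.1 k3, m4, m5, hT'.1 k6⟩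
  · rintro ⟨k1, k2, k3, k4, k5, k6⟩
    obtain ⟨m1, m2, m4, m5⟩ := h4.2 ⟨k1, k2, k4, k5⟩
    exact ⟨m1, m2, hT.2 k3, m4, m5, hT'.2 k6⟩

end PairT

section PairTheoremT
variable {V : Type*} {E : Type*} [Fintype E] [DecidableEq E] {R : Type*} [Field R] [LinearOrder R]
  [IsStrictOrderedRing R]
variable {ends : E → Sym2 V} {W : Set V} {x : V} {P : Finset E} {e₁ e₂ e₃ : E} {w z₁ z₂ : V}
  {o a₁ a₂ a₃ b : V}

/-- **The second pocket reduction for the six-form closed property**: `ClosedAtT a₃` in the tree gadget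
gives `ClosedAtT a₃` in `G`. -/
theorem closedAtT_of_pair (hh : IsPairPocket ends W x P e₁ e₂ e₃ w z₁ z₂) (h1 : a₁ ∉ W) (h2 : a₂ ∉ W)
    (ho : o ∉ W ∨ o = z₁ ∨ o = z₂) (ha : a₃ ∉ W ∨ a₃ = z₁ ∨ a₃ = z₂) (hb : b ∉ W ∨ b = z₁ ∨ b = z₂)
    (hc : ClosedAtT (R := R) o a₁ a₂ b E (pairEnds ends P e₁ e₂ e₃ x w z₁ z₂) a₃) :
    ClosedAtT (R := R) o a₁ a₂ b E ends a₃ :=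
  fun p hp => (sixForms_pair_iff hp hh h1 h2 ho ha hb).2
    (hc (pairW p ends P e₁ e₂ e₃ x z₁ z₂) (IsProbVec.pairW hp ends P x z₁ z₂ e₁ e₂ e₃))

end PairTheoremT

end CaseOne

end Summit.Ventures.PercRepro2
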